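import Summits.KontsevichZagierPeriods.KontsevichZagierPeriods.Theses.HurwitzMicroSectors
import Summits.KontsevichZagierPeriods.KontsevichZagierPeriods.Theorems.HurwitzMicroSectorsNormalFormPrinciplePiBoxTransfer
import Summits.KontsevichZagierPeriods.KontsevichZagierPeriods.Theorems.HurwitzMicroSectorsNormalFormPrincipleVariants2239
import Summits.KontsevichZagierPeriods.KontsevichZagierPeriods.Theorems.HurwitzMicroSectorsNormalFormPrincipleVariants2347

/-! TTRL-lite variant V2335 of stmt-KontsevichZagierPeriods-3869

Variant V2335 = `stub_boxRigidity` (BoxRigidity: two box-rational representations — domain the open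
unit box, integrand `p/q` over `ℚ` — with equal values are KZ-equivalent) under the small-case move
`fix_nat:m=8; bound_nat:m'≤8` (left dimension frozen to `8`, right dimension `m' ≤ 8`).
Verdict of the attempt seat: **open** — this file is the exact-strength certificate, not a proof of
the variant. V2335 is EQUIVALENT to **BoxVanishing in dimension `8`** — every box-rational
representation on `(0,1)⁸` of value `0` is a Kontsevich–Zagier relation
(`stub_boxRigidity_var2335_iff_boxVanishing_eight`: `⇒` compare with the zero representation on the
`0`-box in the right slot; `⇐` pad both sides to `(0,1)⁸` by unit intervals and subtract on the common
box, value `0` by soundness — `boxRigidityLe_of_boxVanishing`, file `…Variants2239`), hence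
equivalent VERBATIM to the recorded-open sibling V2347 (`m' = 2`, `m ≤ 8`;
`stub_boxRigidity_var2335_iff_var2347`) and to BoxRigidity with BOTH dimensions `≤ 8`
(`stub_boxRigidity_var2335_iff_boxRigidityLe_eight`). By monotonicity of BoxVanishing along padding
(`boxVanishing_mono`) V2335 gives BoxVanishing in every dimension `≤ 8`
(`boxVanishingLe_eight_of_stub_boxRigidity_var2335`), in particular BoxVanishing(`2`) (Conjecture 1 for
all rational integrands over `ℚ` on the open unit square: Catalan's `G`, `π log 2`, `log² 2` against
`ℚ`), open; and `KontsevichZagierPeriods → V2335` (`stub_boxRigidity_var2335_of_statement`), so a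
refutation of the variant would refute Conjecture 1 for the tree's calculus (no invariant of
`KZ.relations` beyond `eval` is known). The proved two-sided frontier stays `max j k ≤ 1`
(`boxRigidityLe_of_max_le_one`, Baker).
Source: M. Kontsevich, D. Zagier, *Periods* (2001), §1.2 Conjecture 1 and rules 1)–3).
Pure proof file, no definitions. -/

-- `Summit.<Summit>.<Problem>` is the tree's mandated summit-side namespace (CONVENTIONS §2); for this
-- single-conjunct summit the two coincide, so the duplicate is deliberate.
set_option linter.dupNamespace false

noncomputable section

namespace Summit.KontsevichZagierPeriods.KontsevichZagierPeriods.Theorems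

open MeasureTheory Set
open Literature.NumberTheory.Transcendental Literature.NumberTheory.Transcendental.KZ
open Summit.KontsevichZagierPeriods.KontsevichZagierPeriods.Theses.HurwitzMicroSectors
open Summit.KontsevichZagierPeriods.HurwitzMicroSectors.NormalFormPrinciple.PiBox

/-! ## The variant V2335: Conjecture 1 for box-rational periods of dimension 8 -/

/-- **V2335 ⟺ BoxVanishing in dimension `8`** (every box-rational representation on `(0,1)⁸` of value
`0` is a relation): `⇒` compare a box-rational `N : IntegralRep 8` of value `0` (left slot) with the
zero representation on the `0`-box (right slot, `m' = 0 ≤ 8`; box-rational, value `0`, itself a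
relation); `⇐` pad both representations to `(0,1)⁸` and subtract on the common box, value `0` by
soundness (`boxRigidityLe_of_boxVanishing` with `j = k = K = 8`). [cite: KontsevichZagier2001, §1.2 Conjecture 1] -/
theorem stub_boxRigidity_var2335_iff_boxVanishing_eight :
    (∀ (m' : ℕ) (N : IntegralRep 8) (N' : IntegralRep m'), m' ≤ 8 → N.domain = {x | ∀ i, x i ∈ Set.Ioo (0:ℝ) 1} → N.IsRational → N'.domain = {x | ∀ i, x i ∈ Set.Ioo (0:ℝ) 1} → N'.IsRational → N.value = N'.value → Equivalent N N') ↔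
    (∀ N : IntegralRep 8, N.domain = {x | ∀ i, x i ∈ Set.Ioo (0:ℝ) 1} → N.IsRational →
      N.value = 0 → of N ∈ relations) := by
  refine ⟨fun h N hNd hNr hv => ?_, fun hvan m' N N' hm' =>
    boxRigidityLe_of_boxVanishing (j := 8) (k := 8) (K := 8) le_rfl le_rfl hvan 8 m' N N' hm'
      le_rfl⟩
  obtain ⟨Z, hZd, hZi⟩ := exists_zeroRep (isSemialgebraic_box 0)
  have hZ : of Z ∈ relations := of_mem_relations_of_eqOn_zero Z (by simp [hZi, EqOn])
  have hZv : Z.value = 0 := by simp [IntegralRep.value, hZi]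
  have hZr : Z.IsRational := ⟨0, 1, fun x _ => by simp, fun x _ => by simp [hZi]⟩
  have h' : of N - of Z ∈ relations := h 0 N Z (Nat.zero_le _) hNd hNr hZd hZr (by rw [hv, hZv])
  simpa using relations.add_mem h' hZ

/-- **V2335 ⟺ V2347** (the sibling `fix_nat:m'=2; bound_nat:m≤8`, verbatim its statement; recorded
open): both are BoxVanishing in dimension `8`, so the two one-slot freezes at height `8` are the same
rung. [cite: KontsevichZagier2001, §1.2 Conjecture 1] -/
theorem stub_boxRigidity_var2335_iff_var2347 :
    (∀ (m' : ℕ) (N : IntegralRep 8) (N' : IntegralRep m'), m' ≤ 8 → N.domain = {x | ∀ i, x i ∈ Set.Ioo (0:ℝ) 1} → N.IsRational → N'.domain = {x | ∀ i, x i ∈ Set.Ioo (0:ℝ) 1} → N'.IsRational → N.value = N'.value → Equivalent N N') ↔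
    (∀ (m : ℕ) (N : IntegralRep m) (N' : IntegralRep 2), m ≤ 8 → N.domain = {x | ∀ i, x i ∈ Set.Ioo (0:ℝ) 1} → N.IsRational → N'.domain = {x | ∀ i, x i ∈ Set.Ioo (0:ℝ) 1} → N'.IsRational → N.value = N'.value → Equivalent N N') :=
  stub_boxRigidity_var2335_iff_boxVanishing_eight.trans
    stub_boxRigidity_var2347_iff_boxVanishing_eight.symm

/-- **V2335 ⇒ BoxVanishing in every dimension `≤ 8`** (monotonicity of BoxVanishing along padding,
`boxVanishing_mono`): in particular the recorded-open BoxVanishing(`2`) … BoxVanishing(`≤ 6`) rungs of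
the siblings. [cite: KontsevichZagier2001, §1.2 Conjecture 1] -/
theorem boxVanishingLe_eight_of_stub_boxRigidity_var2335
    (h : ∀ (m' : ℕ) (N : IntegralRep 8) (N' : IntegralRep m'), m' ≤ 8 → N.domain = {x | ∀ i, x i ∈ Set.Ioo (0:ℝ) 1} → N.IsRational → N'.domain = {x | ∀ i, x i ∈ Set.Ioo (0:ℝ) 1} → N'.IsRational → N.value = N'.value → Equivalent N N') :
    ∀ (m : ℕ) (N : IntegralRep m), m ≤ 8 → N.domain = {x | ∀ i, x i ∈ Set.Ioo (0:ℝ) 1} →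
      N.IsRational → N.value = 0 → of N ∈ relations :=
  fun _ N hm => boxVanishing_mono hm (stub_boxRigidity_var2335_iff_boxVanishing_eight.1 h) N

/-- **V2335 ⟺ BoxRigidity with both dimensions `≤ 8`**: the frozen `m = 8` is idle next to `m' ≤ 8`
(the honest strength of the variant: Conjecture 1 for all pairs of rational integrands over `ℚ` on the
open unit boxes of dimension at most `8`). [cite: KontsevichZagier2001, §1.2 Conjecture 1] -/
theorem stub_boxRigidity_var2335_iff_boxRigidityLe_eight :
    (∀ (m' : ℕ) (N : IntegralRep 8) (N' : IntegralRep m'), m' ≤ 8 → N.domain = {x | ∀ i, x i ∈ Set.Ioo (0:ℝ) 1} → N.IsRational → N'.domain = {x | ∀ i, x i ∈ Set.Ioo (0:ℝ) 1} → N'.IsRational → N.value = N'.value → Equivalent N N') ↔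
    (∀ (m m' : ℕ) (N : IntegralRep m) (N' : IntegralRep m'), m ≤ 8 → m' ≤ 8 →
      N.domain = {x | ∀ i, x i ∈ Set.Ioo (0:ℝ) 1} → N.IsRational →
      N'.domain = {x | ∀ i, x i ∈ Set.Ioo (0:ℝ) 1} → N'.IsRational →
      N.value = N'.value → Equivalent N N') :=
  ⟨fun h m m' N N' hm hm' => boxRigidityLe_of_boxVanishing (j := 8) (k := 8) (K := 8) le_rfl le_rfl
      (stub_boxRigidity_var2335_iff_boxVanishing_eight.1 h) m m' N N' hm' hm,
    fun h m' N N' hm' => h 8 m' N N' le_rfl hm'⟩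

/-! ## The other side: the variant is implied by the Summit -/

/-- **The parent leaf ⇒ V2335** (specialisation `m := 8`; the converse is not claimed — the parent
is BoxVanishing in ALL dimensions). [cite: KontsevichZagier2001, §1.2 Conjecture 1] -/
theorem stub_boxRigidity_var2335_of_parent
    (h : ∀ (m m' : ℕ) (N : IntegralRep m) (N' : IntegralRep m'), N.domain = {x | ∀ i, x i ∈ Set.Ioo (0:ℝ) 1} → N.IsRational → N'.domain = {x | ∀ i, x i ∈ Set.Ioo (0:ℝ) 1} → N'.IsRational → N.value = N'.value → Equivalent N N') :
    ∀ (m' : ℕ) (N : IntegralRep 8) (N' : IntegralRep m'), m' ≤ 8 → N.domain = {x | ∀ i, x i ∈ Set.Ioo (0:ℝ) 1} → N.IsRational → N'.domain = {x | ∀ i, x i ∈ Set.Ioo (0:ℝ) 1} → N'.IsRational → N.value = N'.value → Equivalent N N' :=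
  fun m' N N' _ => h 8 m' N N'

/-- **`KontsevichZagierPeriods ⇒ V2335`**: the variant is a special case of Conjecture 1 for the
tree's calculus (`leaves_of_statement`) — a refutation of the variant would refute the Summit.
[cite: KontsevichZagier2001, §1.2 Conjecture 1] -/
theorem stub_boxRigidity_var2335_of_statement (h : _root_.KontsevichZagierPeriods) :
    ∀ (m' : ℕ) (N : IntegralRep 8) (N' : IntegralRep m'), m' ≤ 8 → N.domain = {x | ∀ i, x i ∈ Set.Ioo (0:ℝ) 1} → N.IsRational → N'.domain = {x | ∀ i, x i ∈ Set.Ioo (0:ℝ) 1} → N'.IsRational → N.value = N'.value → Equivalent N N' :=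
  stub_boxRigidity_var2335_of_parent (leaves_of_statement h).1

end Summit.KontsevichZagierPeriods.KontsevichZagierPeriods.Theorems
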